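import Summits.CriticalPhenomena.CardyFormulaZ2.Theorems.CardyBoundaryCoulombGasBoundaryDefectGaussianRStubRealisabilityPart30
import Summits.CriticalPhenomena.CardyFormulaZ2.Theorems.CardyBoundaryCoulombGasBoundaryDefectGaussianRS17StrandTurningPart2
import Summits.CriticalPhenomena.CardyFormulaZ2.Theorems.CardyBoundaryCoulombGasBoundaryDefectGaussianRS17StrandTurningPart3

/-!
# Stub `s17_strandTurning` of line `rainbow-monomials-in-excursion-kernels` — Part 4:
# untracked walks of the oriented medial graph between rim points of the cell region
# (crux `BoundaryDefectGaussianR`, stmt-CriticalPhenomena-14132; insertion dictionary D2, T6)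

The return walk of T6 in a collar leg model `M` (`CollarLegModel`). A corner is TRACKED iff both
sides of its dart are cells of the cell region `U = M.cellRegion` (`isTracked_iff_cornerDart`); the
strands of the model run through tracked corners only, so a walk through UNTRACKED corners never
meets a strand. With `M.V` having king-connected complement and local charts at the first layer
(hypotheses `hK`, `KINGCHART(6)` of `crr_coHoleFree`, Part 30):

* `s17_st4_conn` — two non-cells edge-adjacent to the region are joined by a chain of edge-adjacent
  non-cells (exit to free lattice points, Part 30 `crr_exit_cells`; king paths outside `V` pushed off
  the first layer, Part 25 `crr_push`; `crr_freeChain_cells`);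
* `s17_st4_escape` — a non-cell edge-adjacent to the region is joined by such a chain to non-cells
  arbitrarily far WEST;
* `s17_st4_dartChain` — along such a chain consecutive squares are the two sides of the dart of an
  untracked corner, which lies on no list of darts of tracked corners (input of Part 2);
* `s17_strandTurning_part4` (registered) — between two medial points each carrying the dart of an
  untracked corner with one side in the region (RIM points) there is a nonempty walk of consecutive
  darts of untracked corners without repeated corner (chains of non-cells lifted by Part 3).

Everything is proved; no new definitions.
-/

namespace Summit.CriticalPhenomena.CardyFormulaZ2.Cruxes.BoundaryDefectGaussianR.RainbowMonomialsInExcursionKernels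

open Literature.Probability.LatticeModels Literature.Probability.LatticeModels.CollarLegModel
open Literature.Probability.LatticeModels.MedialTrail
open Literature.Probability.Percolation Literature.Probability.Percolation.CellComplex

/-! ### Cells in coordinates -/

/-- Membership of a square in the transported cell region. [folklore] -/
theorem s17_st4_mem_U_iff (M : CollarLegModel) (F : ℤ × ℤ) :
    (![F.1, F.2] : Fin 2 → ℤ) ∈ M.cellRegion.image (fun F : ℤ × ℤ ↦ (![F.1, F.2] : Fin 2 → ℤ)) ↔ F ∈ M.cellRegion := by
  rw [crr_mem_image_iff]

/-- **Untracked corners border non-cells**: a corner whose dart has a non-cell of the region on its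
left or on its right is not tracked. [folklore] -/
theorem s17_st4_not_tracked (M : CollarLegModel) (a : Fin 2 → ℤ)
    (ha : a ∉ M.cellRegion.image (fun F : ℤ × ℤ ↦ (![F.1, F.2] : Fin 2 → ℤ))) (c : Site 2 × Fin 4)
    (hc : lf (cornerDart c) = (a 0, a 1) ∨ rf (cornerDart c) = (a 0, a 1)) : ¬M.IsTracked c := by
  rw [isTracked_iff_cornerDart]
  have ha' : (a 0, a 1) ∉ M.cellRegion := by
    rw [← s17_st4_mem_U_iff, ← crr_site_eq a]; exact ha
  rintro ⟨h1, h2⟩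
  rcases hc with hc | hc
  · exact ha' (hc ▸ h1)
  · exact ha' (hc ▸ h2)

/-- The two sides of the dart of a corner are edge-adjacent squares. [folklore] -/
theorem s17_st4_sides_adj (c : Site 2 × Fin 4) :
    (![(rf (cornerDart c)).1, (rf (cornerDart c)).2] : Fin 2 → ℤ) =
      (![(lf (cornerDart c)).1, (lf (cornerDart c)).2] : Fin 2 → ℤ) + cornerUnit c.2 := by
  obtain ⟨v, k⟩ := c
  rw [lf_cornerDart, rf_cornerDart, fcell_cFace]
  ext i
  fin_cases i <;> fin_cases k <;> simp [vcell, cornerUnit] <;> ring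

/-- The endpoints of a dart are corner points of the squares on its two sides. [folklore] -/
theorem s17_st4_corner_pts {d : Pt × Pt} (hd : IsDart d.1 d.2) (P : Pt) (hP : P = d.1 ∨ P = d.2) :
    ((lf d).1 ≤ P.1 ∧ P.1 ≤ (lf d).1 + 1 ∧ (lf d).2 ≤ P.2 ∧ P.2 ≤ (lf d).2 + 1) ∧
      ((rf d).1 ≤ P.1 ∧ P.1 ≤ (rf d).1 + 1 ∧ (rf d).2 ≤ P.2 ∧ P.2 ≤ (rf d).2 + 1) := by
  obtain ⟨a, b, rfl | rfl | rfl | rfl⟩ := hd.cases <;> rcases hP with rfl | rfl <;> simp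

section Model

variable (M : CollarLegModel)
  (hK : ∀ u ∉ M.V, ∀ w ∉ M.V, Relation.ReflTransGen
    (fun b c : ℤ × ℤ ↦ b ∉ M.V ∧ c ∉ M.V ∧ max |b.1 - c.1| |b.2 - c.2| ≤ 1) u w)
  (hLS : ∀ z : ℤ × ℤ, z ∉ M.V → (∃ v ∈ M.V, max |v.1 - z.1| |v.2 - z.2| ≤ 1) → ∃ σ τ a c : ℤ, |σ| ≤ 1 ∧ |τ| ≤ 1 ∧
    ((∀ v : ℤ × ℤ, max |v.1 - z.1| |v.2 - z.2| ≤ 6 → (v ∈ M.V ↔ 0 ≤ σ * (v.1 - a) ∧ 0 ≤ τ * (v.2 - c))) ∨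
     (∀ v : ℤ × ℤ, max |v.1 - z.1| |v.2 - z.2| ≤ 6 → (v ∈ M.V ↔ 0 < σ * (v.1 - a) ∨ 0 < τ * (v.2 - c)))))

include hK hLS in
/-- **Non-cells edge-adjacent to the region are joined through non-cells.** [folklore] -/
theorem s17_st4_conn {o o' : Fin 2 → ℤ}
    (ho : o ∉ M.cellRegion.image (fun F : ℤ × ℤ ↦ (![F.1, F.2] : Fin 2 → ℤ)))
    (hadj : ∃ c ∈ M.cellRegion.image (fun F : ℤ × ℤ ↦ (![F.1, F.2] : Fin 2 → ℤ)), CellAdj c o)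
    (ho' : o' ∉ M.cellRegion.image (fun F : ℤ × ℤ ↦ (![F.1, F.2] : Fin 2 → ℤ)))
    (hadj' : ∃ c ∈ M.cellRegion.image (fun F : ℤ × ℤ ↦ (![F.1, F.2] : Fin 2 → ℤ)), CellAdj c o') :
    Relation.ReflTransGen (fun a b ↦ a ∉ M.cellRegion.image (fun F : ℤ × ℤ ↦ (![F.1, F.2] : Fin 2 → ℤ)) ∧
      b ∉ M.cellRegion.image (fun F : ℤ × ℤ ↦ (![F.1, F.2] : Fin 2 → ℤ)) ∧ CellAdj a b) o o' := by
  obtain ⟨e, hNe, hoe⟩ := crr_exit_cells M hLS ho hadj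
  obtain ⟨e', hNe', hoe'⟩ := crr_exit_cells M hLS ho' hadj'
  have heV : e ∉ M.V := fun h => hNe ⟨e, h, by simp⟩
  have he'V : e' ∉ M.V := fun h => hNe' ⟨e', h, by simp⟩
  obtain ⟨y, hy, hNy, hpath⟩ := crr_push hLS (hK e heV e' he'V) hNe
  have hcells := crr_freeChain_cells M (hpath.tail ⟨hNy, hNe', hy⟩)
  exact (hoe.trans hcells).trans (hf_rtg_symm (fun a b h => ⟨h.2.1, h.1, h.2.2.symm⟩) hoe')

include hK hLS in
/-- **Escape to the west.** A non-cell edge-adjacent to the region is joined through non-cells to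
non-cells arbitrarily far west. [folklore] -/
theorem s17_st4_escape {o : Fin 2 → ℤ}
    (ho : o ∉ M.cellRegion.image (fun F : ℤ × ℤ ↦ (![F.1, F.2] : Fin 2 → ℤ)))
    (hadj : ∃ c ∈ M.cellRegion.image (fun F : ℤ × ℤ ↦ (![F.1, F.2] : Fin 2 → ℤ)), CellAdj c o) (X : ℤ) :
    ∃ o' : Fin 2 → ℤ, o' 0 < X ∧
      Relation.ReflTransGen (fun a b ↦ a ∉ M.cellRegion.image (fun F : ℤ × ℤ ↦ (![F.1, F.2] : Fin 2 → ℤ)) ∧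
        b ∉ M.cellRegion.image (fun F : ℤ × ℤ ↦ (![F.1, F.2] : Fin 2 → ℤ)) ∧ CellAdj a b) o o' := by
  obtain ⟨e, hNe, hoe⟩ := crr_exit_cells M hLS ho hadj
  have heV : e ∉ M.V := fun h => hNe ⟨e, h, by simp⟩
  -- a far western target outside `V`
  obtain ⟨B, hB⟩ : ∃ B : ℤ, ∀ v ∈ M.V, -B ≤ v.1 :=
    ⟨∑ v ∈ M.V, |v.1|, fun v hv ↦ by
      have h1 := Finset.single_le_sum (f := fun v : ℤ × ℤ ↦ |v.1|) (fun _ _ ↦ abs_nonneg _) hv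
      have h2 := neg_abs_le v.1
      linarith⟩
  have ht : ((min (X - 3) (-B - 1), 0) : ℤ × ℤ) ∉ M.V := fun h ↦ by
    have := hB _ h; simp only at this; omega
  obtain ⟨y, hy, -, hpath⟩ := crr_push hLS (hK e heV _ ht) hNe
  refine ⟨![y.1 + y.2 - 1, y.2 - y.1], ?_, hoe.trans (crr_freeChain_cells M hpath)⟩
  rw [crr_max_abs_le_iff] at hy
  simp only [Matrix.cons_val_zero] at hy ⊢
  omega

/-- **Consecutive non-cells are the two sides of an untracked dart.** Along a chain of edge-adjacent
non-cells, consecutive squares are the left and right faces of the dart of a corner lying on no list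
of darts of tracked corners. [folklore] -/
theorem s17_st4_dartChain (D D' : List (Pt × Pt)) (hD : ∀ s ∈ D, ∃ c, M.IsTracked c ∧ s = cornerDart c)
    (hD' : ∀ s ∈ D', ∃ c, M.IsTracked c ∧ s = cornerDart c) {o o' : Fin 2 → ℤ}
    (h : Relation.ReflTransGen (fun a b ↦ a ∉ M.cellRegion.image (fun F : ℤ × ℤ ↦ (![F.1, F.2] : Fin 2 → ℤ)) ∧
      b ∉ M.cellRegion.image (fun F : ℤ × ℤ ↦ (![F.1, F.2] : Fin 2 → ℤ)) ∧ CellAdj a b) o o') :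
    Relation.ReflTransGen (fun G G' : Pt ↦ ∃ s : Pt × Pt, IsDart s.1 s.2 ∧ s ∉ D ∧ s ∉ D' ∧
      ((lf s = G ∧ rf s = G') ∨ (lf s = G' ∧ rf s = G))) (o 0, o 1) (o' 0, o' 1) := by
  induction h with
  | refl => exact Relation.ReflTransGen.refl
  | tail _ hst ih =>
    obtain ⟨ha, hb, hab⟩ := hst
    obtain ⟨j, rfl⟩ := (crr_cellAdj_iff _ _).1 hab
    obtain ⟨c, hc⟩ := s17_st2_side _ j
    have hnt : ¬M.IsTracked c := by
      refine s17_st4_not_tracked M _ ha c ?_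
      rcases hc with ⟨h1, -⟩ | ⟨-, h2⟩
      exacts [Or.inl h1, Or.inr h2]
    have hnot : ∀ L : List (Pt × Pt), (∀ s ∈ L, ∃ c, M.IsTracked c ∧ s = cornerDart c) → cornerDart c ∉ L := by
      intro L hL hm
      obtain ⟨c', hc', he⟩ := hL _ hm
      exact hnt (cornerDart_injective he ▸ hc')
    exact ih.tail ⟨cornerDart c, isDart_cornerDart c, hnot D hD, hnot D' hD', hc⟩

include hK hLS in
/-- **Untracked walks between rim points.** If the medial points `P` and `P'` are endpoints of darts
of untracked corners one of whose sides is a cell of the region, then some nonempty list of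
untracked corners without repetition has consecutive darts leading from `P` to `P'`. [folklore] -/
theorem s17_st4_walk {P P' : Pt}
    (hP : ∃ q : Site 2 × Fin 4, ¬M.IsTracked q ∧ (ofSite q.1 ∈ M.vertexCells ∨ ofSite (cFace q) ∈ M.faceCells) ∧
      (cpos q = P ∨ (cornerDart q).2 = P))
    (hP' : ∃ q : Site 2 × Fin 4, ¬M.IsTracked q ∧ (ofSite q.1 ∈ M.vertexCells ∨ ofSite (cFace q) ∈ M.faceCells) ∧
      (cpos q = P' ∨ (cornerDart q).2 = P')) :
    ∃ cs : List (Site 2 × Fin 4), cs.Nodup ∧ cs ≠ [] ∧ (∀ c ∈ cs, ¬M.IsTracked c) ∧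
      List.IsChain (fun c c' : Site 2 × Fin 4 => (cornerDart c).2 = cpos c') cs ∧
      (∀ c, cs.head? = some c → cpos c = P) ∧ (∀ c, cs.getLast? = some c → (cornerDart c).2 = P') := by
  -- a non-cell edge-adjacent to the region at each of the two points
  have key : ∀ Q : Pt, (∃ q : Site 2 × Fin 4, ¬M.IsTracked q ∧
      (ofSite q.1 ∈ M.vertexCells ∨ ofSite (cFace q) ∈ M.faceCells) ∧ (cpos q = Q ∨ (cornerDart q).2 = Q)) →
      ∃ o : Fin 2 → ℤ, o ∉ M.cellRegion.image (fun F : ℤ × ℤ ↦ (![F.1, F.2] : Fin 2 → ℤ)) ∧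
        (∃ c ∈ M.cellRegion.image (fun F : ℤ × ℤ ↦ (![F.1, F.2] : Fin 2 → ℤ)), CellAdj c o) ∧
        (o 0 ≤ Q.1 ∧ Q.1 ≤ o 0 + 1 ∧ o 1 ≤ Q.2 ∧ Q.2 ≤ o 1 + 1) := by
    rintro Q ⟨q, hq, hcell, hQ⟩
    have hpts := s17_st4_corner_pts (isDart_cornerDart q) Q (by rcases hQ with h | h; exacts [Or.inl h.symm, Or.inr h.symm])
    rw [isTracked_iff_cornerDart] at hq
    rw [← mem_cellRegion_vcell_iff, ← mem_cellRegion_fcell_iff, ← lf_cornerDart, ← rf_cornerDart] at hcell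
    have hadj : CellAdj (![(lf (cornerDart q)).1, (lf (cornerDart q)).2] : Fin 2 → ℤ)
        ![(rf (cornerDart q)).1, (rf (cornerDart q)).2] := by
      rw [s17_st4_sides_adj]; exact crr_cellAdj_add_unit _ _
    rcases hcell with h1 | h2
    · have h2 : rf (cornerDart q) ∉ M.cellRegion := fun h2 => hq ⟨h1, h2⟩
      refine ⟨![(rf (cornerDart q)).1, (rf (cornerDart q)).2], by rwa [s17_st4_mem_U_iff],
        ⟨_, by rwa [s17_st4_mem_U_iff], hadj⟩, ?_⟩
      simpa using hpts.2
    · have h1 : lf (cornerDart q) ∉ M.cellRegion := fun h1 => hq ⟨h1, h2⟩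
      refine ⟨![(lf (cornerDart q)).1, (lf (cornerDart q)).2], by rwa [s17_st4_mem_U_iff],
        ⟨_, by rwa [s17_st4_mem_U_iff], hadj.symm⟩, ?_⟩
      simpa using hpts.1
  obtain ⟨o, ho, hadj, hPo⟩ := key P hP
  obtain ⟨o', ho', hadj', hPo'⟩ := key P' hP'
  have hchain : Relation.ReflTransGen (fun a b ↦ a ∉ M.cellRegion.image (fun F : ℤ × ℤ ↦ (![F.1, F.2] : Fin 2 → ℤ)) ∧
      b ∉ M.cellRegion.image (fun F : ℤ × ℤ ↦ (![F.1, F.2] : Fin 2 → ℤ)) ∧ ∃ j : Fin 4, b = a + cornerUnit j) o o' :=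
    Relation.ReflTransGen.mono (fun a b h => ⟨h.1, h.2.1, (crr_cellAdj_iff _ _).1 h.2.2⟩) _ _
      (s17_st4_conn M hK hLS ho hadj ho' hadj')
  exact s17_strandTurning_part3 M.IsTracked (fun a => a ∉ M.cellRegion.image (fun F : ℤ × ℤ ↦ (![F.1, F.2] : Fin 2 → ℤ)))
    (fun a ha c hc => s17_st4_not_tracked M a ha c hc) o o' hchain ho P P' hPo hPo'

end Model

/-- **Registered sub-goal `s17_strandTurning_part4`: untracked return walks exist.** For a collar
leg model whose vertex set has king-connected complement and local charts at its first layer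
(radius `6`), if the medial points `P` and `P'` are endpoints of darts of UNTRACKED corners one of
whose two sides is a cell of the model (rim points of the cell region), then there is a nonempty
list of untracked corners without repetition whose darts are consecutive, the first starting at `P`
and the last ending at `P'` (non-cells beside the region are joined through edge-adjacent non-cells,
Parts 25/30; chains of non-cells lift to walks, Part 3). [folklore] -/
theorem s17_strandTurning_part4 : ∀ (M : Literature.Probability.LatticeModels.CollarLegModel), (∀ u ∉ M.V, ∀ w ∉ M.V, Relation.ReflTransGen (fun b c : ℤ × ℤ ↦ b ∉ M.V ∧ c ∉ M.V ∧ max |b.1 - c.1| |b.2 - c.2| ≤ 1) u w) → (∀ z : ℤ × ℤ, z ∉ M.V → (∃ v ∈ M.V, max |v.1 - z.1| |v.2 - z.2| ≤ 1) → ∃ σ τ a c : ℤ, |σ| ≤ 1 ∧ |τ| ≤ 1 ∧ ((∀ v : ℤ × ℤ, max |v.1 - z.1| |v.2 - z.2| ≤ 6 → (v ∈ M.V ↔ 0 ≤ σ * (v.1 - a) ∧ 0 ≤ τ * (v.2 - c))) ∨ (∀ v : ℤ × ℤ, max |v.1 - z.1| |v.2 - z.2| ≤ 6 → (v ∈ M.V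 ↔ 0 < σ * (v.1 - a) ∨ 0 < τ * (v.2 - c))))) → ∀ (P P' : ℤ × ℤ), (∃ q : Literature.Probability.LatticeModels.Site 2 × Fin 4, ¬M.IsTracked q ∧ (Literature.Probability.LatticeModels.CollarLegModel.ofSite q.1 ∈ M.vertexCells ∨ Literature.Probability.LatticeModels.CollarLegModel.ofSite (Literature.Probability.LatticeModels.cFace q) ∈ M.faceCells) ∧ (Literature.Probability.LatticeModels.cpos q = P ∨ (Literature.Probability.Percolation.cornerDart q).2 = P)) → (∃ q : Literature.Probability.LatticeModels.Site 2 × Fin 4, ¬M.IsTracked q ∧ (Literature.Probability.LatticeModels.CollarLegModel.ofSite q.1 ∈ M.vertexCells ∨ Literature.Probability.LatticeModels.CollarLegModel.ofSite (Literature.Probability.LatticeModels.cFace q) ∈ M.faceCells) ∧ (Literature.Probability.LatticeModels.cpos q = P' ∨ (Literature.Probability.Percolation.cornerDart q).2 = P')) → ∃ cs : List (Literature.Probability.LatticeModels.Site 2 × Fin 4), cs.Nodup ∧ cs ≠ [] ∧ (∀ c ∈ cs, ¬M.IsTracked c) ∧ List.IsChain (fun c c' : Literature.Probability.LatticeModels.Site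 2 × Fin 4 => (Literature.Probability.Percolation.cornerDart c).2 = Literature.Probability.LatticeModels.cpos c') cs ∧ (∀ c, cs.head? = some c → Literature.Probability.LatticeModels.cpos c = P) ∧ (∀ c, cs.getLast? = some c → (Literature.Probability.Percolation.cornerDart c).2 = P') :=
  fun M hK hLS _ _ hP hP' => s17_st4_walk M hK hLS hP hP'

end Summit.CriticalPhenomena.CardyFormulaZ2.Cruxes.BoundaryDefectGaussianR.RainbowMonomialsInExcursionKernels
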